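import Literature.Analysis.FluidPDE.HolderHalfDirectionStretching
import HarnessLib

/-!
# CriticalCoherenceDoorRiesz — door S33 «CriticalCoherenceDoor» (nsreg-p1 ROUND-31, texts
# `r31/Sketch33.lean` ae52fe0f17f630b4), plate T33: the Riesz-potential count of the depleted term

The HIGH × HIGH term of the two-threshold stretching estimate, after the geometric depletion
(`…CriticalCoherenceDoorDepletion`), is a density `G` with the pointwise majorant
`|G(x)| ≤ A M |ω(x)|² ∫ |x − y|^{-5/2} |ω_hi(y)| dy` (`ω = curl v`, `ω_hi` the tree's high part at the
`y`-threshold `R`). This file isolates, VERBATIM from the tree's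
`exists_two_mul_integral_stretching_le_of_holderHalf` (steps (i)–(vi) of its `u_hi` block), the bound
`∫ G ≤ A M (c_n √Y t³ + c_f (1 + √Y) √Y Y)`, `Y = ∫|ω|²`, `t = √(K √D)`, `D = ∫|∇ω|²_F`,
`K = K_Sob + 1`, `c_n = 6|B₁|`, `c_f = √(3|B₁|/2)` — the two-radii inequality
`lintegral_mul_rieszHalfPotential_le_two_radii` at `δ = (1 + √Y)⁻¹`, Ladyzhenskaya
`∫|ω|⁴ ≤ ‖ω‖₂ (K‖∇ω‖₂)³` and the Sobolev inequality — so that the stretching file only assembles.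
Nothing here sees any threshold.

HONEST FRAME: S33 is a regularity CRITERION (coherent scale-critical intense set ⇒ continuation),
Type-II-inclusive; nothing here bears on item 0056 `NoTypeII` or on NS regularity itself.
-/

noncomputable section

set_option linter.dupNamespace false

namespace Summit.NavierStokesRegularity.NavierStokesRegularity.Theorems.CriticalCoherenceDoor

open MeasureTheory Set Function Filter Metric Real InnerProductSpace
open _root_.Topology
open scoped ENNReal NNReal RealInnerProductSpace
open Literature.Analysis Literature.Analysis.FluidPDE

-- nested operator types (second derivatives)
set_option maxSynthPendingDepth 3

set_option maxHeartbeats 1600000 in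
/-- **The Riesz-potential count of the depleted term** (verbatim block of the tree's
`exists_two_mul_integral_stretching_le_of_holderHalf`): for a `C²` field `v` with `∇v, ∇²v ∈ L²`, the
high part `ω_hi = (1 − θ_R(ω)) ω` of `ω = curl v` compactly supported, and an integrable density `G`
with `|G(x)| ≤ A M |ω(x)|² ∫ |x − y|^{-5/2} |ω_hi(y)| dy`, one has
`∫ G ≤ A M (c_n √Y t³ + c_f ((1 + √Y) √Y Y))` with `Y = ∫|ω|²`, `D = ∫|∇ω|²_F`,
`t = √((K_Sob + 1) √D)`, `c_n = 6|B₁|`, `c_f = √(3|B₁|/2)`. [folklore] -/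
theorem integral_le_of_depletedMajorant
    {v : (EuclideanSpace ℝ (Fin 3)) → (EuclideanSpace ℝ (Fin 3))} (hv : ContDiff ℝ 2 v)
    (hG : Integrable fun x => ‖fderiv ℝ v x‖ ^ 2)
    (hH : Integrable fun x => ‖fderiv ℝ (fderiv ℝ v) x‖ ^ 2)
    {R A M : ℝ} (hA : 0 ≤ A) (hM : 0 ≤ M)
    (hhic : HasCompactSupport fun y => (1 - radialCutoff R (2 * R) (curl v y)) • curl v y)
    {Gt : (EuclideanSpace ℝ (Fin 3)) → ℝ} (IGt : Integrable Gt)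
    (hGpt : ∀ x, |Gt x| ≤ A * M * ‖curl v x‖ ^ 2 *
        ∫ y, ‖x - y‖ ^ (-(5 / 2 : ℝ)) * ‖(1 - radialCutoff R (2 * R) (curl v y)) • curl v y‖) :
    ∫ x, Gt x ≤ A * M *
      (6 * (volume : Measure (EuclideanSpace ℝ (Fin 3))).real (ball 0 1) *
            Real.sqrt (∫ x, ‖curl v x‖ ^ 2) *
          Real.sqrt ((((SNormLESNormFDerivOfEqConst (EuclideanSpace ℝ (Fin 3))
              (volume : Measure (EuclideanSpace ℝ (Fin 3))) 2 : ℝ≥0) : ℝ) + 1) *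
            Real.sqrt (∫ x, frobeniusNormSq (fderiv ℝ (curl v) x))) ^ 3 +
        Real.sqrt (3 * (volume : Measure (EuclideanSpace ℝ (Fin 3))).real (ball 0 1) / 2) *
          ((1 + Real.sqrt (∫ x, ‖curl v x‖ ^ 2)) * Real.sqrt (∫ x, ‖curl v x‖ ^ 2) *
            ∫ x, ‖curl v x‖ ^ 2)) := by
  set K₀ : ℝ≥0 := SNormLESNormFDerivOfEqConst (EuclideanSpace ℝ (Fin 3))
    (volume : Measure (EuclideanSpace ℝ (Fin 3))) 2 with hK₀
  set K : ℝ := (K₀ : ℝ) + 1 with hK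
  have hK0 : 0 < K := by rw [hK]; positivity
  set v₁ : ℝ := (volume : Measure (EuclideanSpace ℝ (Fin 3))).real (ball 0 1) with hv₁
  have hv₁0 : 0 ≤ v₁ := measureReal_nonneg
  set cn : ℝ := 6 * v₁ with hcn
  have hcn0 : 0 ≤ cn := by positivity
  set cf : ℝ := Real.sqrt (3 * v₁ / 2) with hcf
  have hcf0 : 0 ≤ cf := Real.sqrt_nonneg _
  -- ### basic objects
  have hv1 : ContDiff ℝ 1 v := hv.of_le (by norm_num)
  have hω1 : ContDiff ℝ 1 (curl v) := contDiff_curl (n := 1) (by exact hv)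
  have hωc : Continuous (curl v) := hω1.continuous
  have hDω : Continuous (fderiv ℝ (curl v)) := hω1.continuous_fderiv one_ne_zero
  have hωle : ∀ x, ‖curl v x‖ ≤ ‖curlCLM‖ * ‖fderiv ℝ v x‖ := fun x => norm_curl_le v x
  have hDωle : ∀ x, ‖fderiv ℝ (curl v) x‖ ≤ ‖curlCLM‖ * ‖fderiv ℝ (fderiv ℝ v) x‖ := fun x => by
    rw [fderiv_curl hv]
    exact ContinuousLinearMap.opNorm_comp_le _ _
  have Iω : Integrable fun x => ‖curl v x‖ ^ 2 := by
    refine (hG.const_mul (‖curlCLM‖ ^ 2)).mono' ((hωc.norm.pow 2).aestronglyMeasurable)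
      (Eventually.of_forall fun x => ?_)
    rw [Real.norm_of_nonneg (sq_nonneg _), ← mul_pow]
    exact pow_le_pow_left₀ (norm_nonneg _) (hωle x) 2
  have IDω : Integrable fun x => ‖fderiv ℝ (curl v) x‖ ^ 2 := by
    refine (hH.const_mul (‖curlCLM‖ ^ 2)).mono' ((hDω.norm.pow 2).aestronglyMeasurable)
      (Eventually.of_forall fun x => ?_)
    rw [Real.norm_of_nonneg (sq_nonneg _), ← mul_pow]
    exact pow_le_pow_left₀ (norm_nonneg _) (hDωle x) 2
  have Ifω : Integrable fun x => frobeniusNormSq (fderiv ℝ (curl v) x) := by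
    refine (IDω.const_mul 3).mono' (continuous_frobeniusNormSq_fderiv hω1 one_ne_zero).aestronglyMeasurable
      (Eventually.of_forall fun x => ?_)
    rw [Real.norm_of_nonneg (frobeniusNormSq_nonneg _)]
    exact frobeniusNormSq_le_three_mul _
  -- ### the quantities
  set Y : ℝ := ∫ x, ‖curl v x‖ ^ 2 with hY
  set D : ℝ := ∫ x, frobeniusNormSq (fderiv ℝ (curl v) x) with hD
  set Dop : ℝ := ∫ x, ‖fderiv ℝ (curl v) x‖ ^ 2 with hDop
  have hY0 : 0 ≤ Y := integral_nonneg fun x => sq_nonneg _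
  have hD0 : 0 ≤ D := integral_nonneg fun x => frobeniusNormSq_nonneg _
  have hDopD : Dop ≤ D := integral_mono IDω Ifω fun x => sq_opNorm_le_frobeniusNormSq _
  set sY : ℝ := Real.sqrt Y with hsY
  set sD : ℝ := Real.sqrt D with hsD
  have hsY0 : 0 ≤ sY := Real.sqrt_nonneg _
  have hsD0 : 0 ≤ sD := Real.sqrt_nonneg _
  have hsDop : Real.sqrt Dop ≤ sD := Real.sqrt_le_sqrt hDopD
  have hDω2 : (eLpNorm (fderiv ℝ (curl v)) 2 volume).toReal = Real.sqrt Dop :=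
    toReal_eLpNorm_two_eq_sqrt hDω IDω
  have hωm2 : MemLp (curl v) 2 volume := (memLp_two_iff_integrable_sq_norm hωc.aestronglyMeasurable).2 Iω
  have hDωm2 : MemLp (fderiv ℝ (curl v)) 2 volume :=
    (memLp_two_iff_integrable_sq_norm hDω.aestronglyMeasurable).2 IDω
  -- Sobolev `‖ω‖₆ ≤ K ‖∇ω‖₂ ≤ K √D`
  have hsob := eLpNorm_six_le_eLpNorm_fderiv_two (volume : Measure (EuclideanSpace ℝ (Fin 3)))
    (F := (EuclideanSpace ℝ (Fin 3))) finrank_euclideanSpace_fin hω1 hωm2.eLpNorm_lt_top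
  have hDω_eq : eLpNorm (fderiv ℝ (curl v)) 2 volume = ENNReal.ofReal (Real.sqrt Dop) := by
    rw [← hDω2, ENNReal.ofReal_toReal hDωm2.eLpNorm_lt_top.ne]
  have hK₀K : (K₀ : ℝ≥0∞) ≤ ENNReal.ofReal K := by
    rw [hK, show ((K₀ : ℝ) + 1 : ℝ) = ((K₀ + 1 : ℝ≥0) : ℝ) by push_cast; ring,
      ENNReal.ofReal_coe_nnreal]
    exact_mod_cast le_self_add
  have hω6e : eLpNorm (curl v) 6 volume ≤ ENNReal.ofReal (K * sD) := by
    refine hsob.trans ?_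
    rw [hDω_eq, ENNReal.ofReal_mul hK0.le]
    exact mul_le_mul' hK₀K (ENNReal.ofReal_le_ofReal hsDop)
  -- the high part
  set hi : (EuclideanSpace ℝ (Fin 3)) → (EuclideanSpace ℝ (Fin 3)) :=
    fun y => (1 - radialCutoff R (2 * R) (curl v y)) • curl v y with hhi
  have hhi_le : ∀ y, ‖hi y‖ ≤ ‖curl v y‖ := fun y => norm_highPart_le_norm (curl v) R y
  have hhicont : Continuous hi := (contDiff_highPart hω1 R).continuous
  have hPint : ∀ x, Integrable fun y => ‖x - y‖ ^ (-(5 / 2 : ℝ)) * ‖hi y‖ := by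
    intro x
    -- domination by `sup|hi| · 1_{ball}(x−y)|x−y|^{-5/2}`
    obtain ⟨M₀, hM₀⟩ := hhicont.bounded_above_of_compact_support hhic
    have hM₀0 : 0 ≤ M₀ := (norm_nonneg _).trans (hM₀ x)
    obtain ⟨R₀, hR₀⟩ := hhic.isCompact.isBounded.subset_closedBall (0 : (EuclideanSpace ℝ (Fin 3)))
    set ρ' : ℝ := |R₀| + ‖x‖ + 1 with hρ'
    have hball : Integrable fun z : (EuclideanSpace ℝ (Fin 3)) =>
        (ball (0 : (EuclideanSpace ℝ (Fin 3))) ρ').indicator (fun z => ‖z‖ ^ (-(5 / 2 : ℝ))) z := by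
      rw [integrable_indicator_iff measurableSet_ball]
      exact NewtonPotentialHolder.integrableOn_ball_norm_rpow_neg (by norm_num) ρ'
    have hmaj : Integrable fun y => M₀ *
        (ball (0 : (EuclideanSpace ℝ (Fin 3))) ρ').indicator (fun z => ‖z‖ ^ (-(5 / 2 : ℝ))) (x - y) :=
      (hball.comp_sub_left x).const_mul _
    have hmeas : AEStronglyMeasurable (fun y => ‖x - y‖ ^ (-(5 / 2 : ℝ)) * ‖hi y‖) volume :=
      (((measurable_const.sub measurable_id).norm.pow_const _).mul
        hhicont.measurable.norm).aestronglyMeasurable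
    refine hmaj.mono' hmeas (Eventually.of_forall fun y => ?_)
    have hk0 : 0 ≤ ‖x - y‖ ^ (-(5 / 2 : ℝ)) := Real.rpow_nonneg (norm_nonneg _) _
    rw [Real.norm_of_nonneg (mul_nonneg hk0 (norm_nonneg _))]
    by_cases hy : hi y = 0
    · rw [hy, norm_zero, mul_zero]
      exact mul_nonneg hM₀0 (indicator_nonneg (fun z _ => Real.rpow_nonneg (norm_nonneg _) _) _)
    · have hyR : ‖y‖ ≤ R₀ := mem_closedBall_zero_iff.1 (hR₀ (subset_tsupport _ (mem_support.2 hy)))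
      have hxy : ‖x - y‖ < ρ' := by
        calc ‖x - y‖ ≤ ‖x‖ + ‖y‖ := norm_sub_le _ _
          _ < |R₀| + ‖x‖ + 1 := by linarith [le_abs_self R₀]
      have hmem : x - y ∈ ball (0 : (EuclideanSpace ℝ (Fin 3))) ρ' := mem_ball_zero_iff.2 hxy
      rw [indicator_of_mem hmem]
      calc ‖x - y‖ ^ (-(5 / 2 : ℝ)) * ‖hi y‖ ≤ ‖x - y‖ ^ (-(5 / 2 : ℝ)) * M₀ :=
            mul_le_mul_of_nonneg_left (hM₀ y) hk0
        _ = M₀ * ‖x - y‖ ^ (-(5 / 2 : ℝ)) := mul_comm _ _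
  -- ### the count (verbatim from the tree)
  set t : ℝ := Real.sqrt (K * sD) with htdef
  have ht0 : 0 ≤ t := Real.sqrt_nonneg _
  have hKsD : 0 ≤ K * sD := mul_nonneg hK0.le hsD0
  show ∫ x, Gt x ≤ A * M * (cn * sY * t ^ 3 + cf * ((1 + sY) * sY * Y))
  -- (i) `∫ G ≤ ∫ |G| = (∫⁻ ‖G‖ₑ).toReal`
  have h1 : ∫ x, Gt x ≤ ∫ x, ‖Gt x‖ := integral_mono IGt IGt.norm fun x => le_abs_self _
  rw [integral_norm_eq_lintegral_enorm IGt.aestronglyMeasurable] at h1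
  -- (ii) the `ℝ≥0∞` objects
  set Φ : (EuclideanSpace ℝ (Fin 3)) → ℝ≥0∞ := fun x => ‖curl v x‖ₑ ^ 2 with hΦ
  set Fh : (EuclideanSpace ℝ (Fin 3)) → ℝ≥0∞ := fun y => ‖hi y‖ₑ with hFh
  have hΦm : Measurable Φ := hωc.measurable.enorm.pow_const 2
  have hFm : Measurable Fh := hhicont.measurable.enorm
  set Pe : (EuclideanSpace ℝ (Fin 3)) → ℝ≥0∞ := fun x =>
    ∫⁻ y, Fh y * ENNReal.ofReal (‖x - y‖ ^ (-(5 / 2 : ℝ))) with hPe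
  have hPeq : ∀ x, ENNReal.ofReal (∫ y, ‖x - y‖ ^ (-(5 / 2 : ℝ)) * ‖hi y‖) = Pe x := by
    intro x
    rw [ofReal_integral_eq_lintegral_ofReal (hPint x) (Eventually.of_forall fun y =>
      mul_nonneg (Real.rpow_nonneg (norm_nonneg _) _) (norm_nonneg _))]
    refine lintegral_congr fun y => ?_
    rw [ENNReal.ofReal_mul (Real.rpow_nonneg (norm_nonneg _) _), ofReal_norm, mul_comm]
  have hpt : ∀ x, ‖Gt x‖ₑ ≤ ENNReal.ofReal (A * M) * (Φ x * Pe x) := by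
    intro x
    rw [Real.enorm_eq_ofReal_abs]
    refine (ENNReal.ofReal_le_ofReal (hGpt x)).trans (le_of_eq ?_)
    rw [ENNReal.ofReal_mul (by positivity : 0 ≤ A * M * ‖curl v x‖ ^ 2),
      ENNReal.ofReal_mul (by positivity : 0 ≤ A * M), hPeq x, hΦ]
    simp only
    rw [ENNReal.ofReal_pow (norm_nonneg _), ofReal_norm, mul_assoc]
  have h2 : ∫⁻ x, ‖Gt x‖ₑ ≤ ENNReal.ofReal (A * M) * ∫⁻ x, Φ x * Pe x := by
    calc ∫⁻ x, ‖Gt x‖ₑ ≤ ∫⁻ x, ENNReal.ofReal (A * M) * (Φ x * Pe x) := lintegral_mono hpt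
      _ = ENNReal.ofReal (A * M) * ∫⁻ x, Φ x * Pe x :=
          lintegral_const_mul' _ _ ENNReal.ofReal_ne_top
  -- (iii) the two-radii bound at `δ = (1 + √Y)⁻¹`
  set δ : ℝ := (1 + sY)⁻¹ with hδ
  have hδ0 : 0 < δ := by rw [hδ]; positivity
  have h3 := lintegral_mul_rieszHalfPotential_le_two_radii hΦm hFm hδ0
  -- (iv) the sizes: `∫Φ = Y`, `∫F² ≤ Y`, `∫Φ² ≤ √Y (K√D)³`
  have hΦ1 : ∫⁻ x, Φ x = ENNReal.ofReal Y := by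
    rw [hY, ofReal_integral_eq_lintegral_ofReal Iω (Eventually.of_forall fun x => sq_nonneg _)]
    refine lintegral_congr fun x => ?_
    rw [hΦ]; simp only
    rw [ENNReal.ofReal_pow (norm_nonneg _), ofReal_norm]
  have hF2 : ∫⁻ y, Fh y ^ 2 ≤ ENNReal.ofReal Y := by
    rw [← hΦ1]
    refine lintegral_mono fun y => ?_
    rw [hFh, hΦ]; simp only
    rw [← ofReal_norm, ← ofReal_norm]
    exact pow_le_pow_left' (ENNReal.ofReal_le_ofReal (hhi_le y)) 2
  have hF2r : (∫⁻ y, Fh y ^ 2) ^ (1 / 2 : ℝ) ≤ ENNReal.ofReal sY := by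
    refine (ENNReal.rpow_le_rpow hF2 (by norm_num)).trans (le_of_eq ?_)
    rw [ENNReal.ofReal_rpow_of_nonneg hY0 (by norm_num), hsY, Real.sqrt_eq_rpow]
  have hΦ2 : ∫⁻ x, Φ x ^ 2 ≤ ENNReal.ofReal (sY * (K * sD) ^ 3) := by
    have hcs := ENNReal.lintegral_mul_le_Lp_mul_Lq volume Real.HolderConjugate.two_two
      (hωc.measurable.enorm).aemeasurable ((hωc.measurable.enorm).pow_const 3).aemeasurable
    simp only [Pi.mul_apply] at hcs
    have e2 : ∀ (G : (EuclideanSpace ℝ (Fin 3)) → ℝ≥0∞), ∫⁻ x, G x ^ (2 : ℝ) = ∫⁻ x, G x ^ 2 :=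
      fun G => lintegral_congr fun x => by
        rw [show (2 : ℝ) = ((2 : ℕ) : ℝ) by norm_num, ENNReal.rpow_natCast]
    rw [e2, e2] at hcs
    have hlhs : ∫⁻ x, Φ x ^ 2 = ∫⁻ x, ‖curl v x‖ₑ * ‖curl v x‖ₑ ^ 3 :=
      lintegral_congr fun x => by rw [hΦ]; simp only; ring
    have hY2 : (∫⁻ x, ‖curl v x‖ₑ ^ 2) ^ (1 / (2 : ℝ)) = ENNReal.ofReal sY := by
      have : ∫⁻ x, ‖curl v x‖ₑ ^ 2 = ENNReal.ofReal Y := hΦ1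
      rw [this, ENNReal.ofReal_rpow_of_nonneg hY0 (by norm_num), hsY, Real.sqrt_eq_rpow]
    have h6 : ∫⁻ x, (‖curl v x‖ₑ ^ 3) ^ 2 ≤ ENNReal.ofReal (K * sD) ^ (6 : ℝ) := by
      have hrepr := eLpNorm_eq_lintegral_rpow_enorm_toReal (μ := volume) (f := curl v)
        (by norm_num : (6 : ℝ≥0∞) ≠ 0) (by norm_num : (6 : ℝ≥0∞) ≠ ⊤)
      have h6r : (6 : ℝ≥0∞).toReal = 6 := by norm_num
      rw [h6r] at hrepr
      have hI : ∫⁻ x, ‖curl v x‖ₑ ^ (6 : ℝ) = eLpNorm (curl v) 6 volume ^ (6 : ℝ) := by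
        rw [hrepr, ← ENNReal.rpow_mul]; norm_num
      have hpt6 : ∀ x, (‖curl v x‖ₑ ^ 3) ^ 2 = ‖curl v x‖ₑ ^ (6 : ℝ) := fun x => by
        rw [← pow_mul, show (6 : ℝ) = ((6 : ℕ) : ℝ) by norm_num, ENNReal.rpow_natCast]
      simp_rw [hpt6]
      rw [hI]
      exact ENNReal.rpow_le_rpow hω6e (by norm_num)
    have h6r : (∫⁻ x, (‖curl v x‖ₑ ^ 3) ^ 2) ^ (1 / (2 : ℝ)) ≤ ENNReal.ofReal ((K * sD) ^ 3) := by
      refine (ENNReal.rpow_le_rpow h6 (by norm_num)).trans (le_of_eq ?_)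
      rw [← ENNReal.rpow_mul, show (6 : ℝ) * (1 / 2) = ((3 : ℕ) : ℝ) by norm_num,
        ENNReal.rpow_natCast, ENNReal.ofReal_pow hKsD]
    rw [hlhs]
    calc ∫⁻ x, ‖curl v x‖ₑ * ‖curl v x‖ₑ ^ 3
        ≤ (∫⁻ x, ‖curl v x‖ₑ ^ 2) ^ (1 / (2 : ℝ)) * (∫⁻ x, (‖curl v x‖ₑ ^ 3) ^ 2) ^ (1 / (2 : ℝ)) := hcs
      _ ≤ ENNReal.ofReal sY * ENNReal.ofReal ((K * sD) ^ 3) := by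
          rw [hY2]; exact mul_le_mul_right h6r _
      _ = ENNReal.ofReal (sY * (K * sD) ^ 3) := (ENNReal.ofReal_mul hsY0).symm
  have hΦ2r : (∫⁻ x, Φ x ^ 2) ^ (1 / 2 : ℝ) ≤ ENNReal.ofReal (Real.sqrt (sY * (K * sD) ^ 3)) := by
    refine (ENNReal.rpow_le_rpow hΦ2 (by norm_num)).trans (le_of_eq ?_)
    rw [ENNReal.ofReal_rpow_of_nonneg (by positivity) (by norm_num), Real.sqrt_eq_rpow]
  -- (v) assemble in `ℝ≥0∞`, then pass to `ℝ`
  set W : ℝ := cn * Real.sqrt δ * (Real.sqrt (sY * (K * sD) ^ 3) * sY) + cf / δ * sY * Y with hW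
  have hW0 : 0 ≤ W := by positivity
  have h4 : ∫⁻ x, Φ x * Pe x ≤ ENNReal.ofReal W := by
    refine h3.trans ?_
    have ha : ENNReal.ofReal (6 * v₁ * Real.sqrt δ) *
        ((∫⁻ x, Φ x ^ 2) ^ (1 / 2 : ℝ) * (∫⁻ y, Fh y ^ 2) ^ (1 / 2 : ℝ)) ≤
        ENNReal.ofReal (cn * Real.sqrt δ * (Real.sqrt (sY * (K * sD) ^ 3) * sY)) := by
      rw [ENNReal.ofReal_mul (by positivity : 0 ≤ cn * Real.sqrt δ),
        ENNReal.ofReal_mul (Real.sqrt_nonneg _), hcn]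
      exact mul_le_mul_right (mul_le_mul' hΦ2r hF2r) _
    have hb : ENNReal.ofReal (Real.sqrt (3 * v₁ / 2) / δ) * (∫⁻ y, Fh y ^ 2) ^ (1 / 2 : ℝ) *
        (∫⁻ x, Φ x) ≤ ENNReal.ofReal (cf / δ * sY * Y) := by
      rw [hΦ1, ENNReal.ofReal_mul (by positivity : 0 ≤ cf / δ * sY),
        ENNReal.ofReal_mul (by positivity : 0 ≤ cf / δ), hcf]
      exact mul_le_mul_left (mul_le_mul_right hF2r _) _
    calc _ ≤ ENNReal.ofReal (cn * Real.sqrt δ * (Real.sqrt (sY * (K * sD) ^ 3) * sY)) +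
          ENNReal.ofReal (cf / δ * sY * Y) := add_le_add ha hb
      _ = ENNReal.ofReal W := by rw [hW, ENNReal.ofReal_add (by positivity) (by positivity)]
  have h5 : (∫⁻ x, ‖Gt x‖ₑ).toReal ≤ A * M * W := by
    have h := h2.trans (mul_le_mul_right h4 _)
    rw [← ENNReal.ofReal_mul (by positivity)] at h
    have h' := ENNReal.toReal_mono ENNReal.ofReal_ne_top h
    rwa [ENNReal.toReal_ofReal (by positivity)] at h'
  -- (vi) the choice of `δ`: `√δ √(√Y (K√D)³) ≤ t³`, `cf/δ = cf (1 + √Y)`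
  have hWle : W ≤ cn * sY * t ^ 3 + cf * ((1 + sY) * sY * Y) := by
    have hsq : Real.sqrt δ * Real.sqrt (sY * (K * sD) ^ 3) ≤ t ^ 3 := by
      rw [← Real.sqrt_mul hδ0.le]
      have hle : δ * (sY * (K * sD) ^ 3) ≤ (K * sD) ^ 3 := by
        have hfrac : δ * sY ≤ 1 := by
          rw [hδ, inv_mul_le_iff₀ (by positivity : (0 : ℝ) < 1 + sY)]
          linarith
        calc δ * (sY * (K * sD) ^ 3) = (δ * sY) * (K * sD) ^ 3 := by ring
          _ ≤ 1 * (K * sD) ^ 3 := mul_le_mul_of_nonneg_right hfrac (by positivity)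
          _ = (K * sD) ^ 3 := one_mul _
      calc Real.sqrt (δ * (sY * (K * sD) ^ 3)) ≤ Real.sqrt ((K * sD) ^ 3) := Real.sqrt_le_sqrt hle
        _ = t ^ 3 := by
            rw [htdef, show (K * sD) ^ 3 = (K * sD) ^ 2 * (K * sD) by ring,
              Real.sqrt_mul (by positivity), Real.sqrt_sq hKsD]
            rw [show Real.sqrt (K * sD) ^ 3 = Real.sqrt (K * sD) ^ 2 * Real.sqrt (K * sD) by ring,
              Real.sq_sqrt hKsD]
    have hδinv : cf / δ = cf * (1 + sY) := by
      rw [hδ, div_inv_eq_mul]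
    rw [hW, hδinv]
    have : cn * Real.sqrt δ * (Real.sqrt (sY * (K * sD) ^ 3) * sY) =
        cn * sY * (Real.sqrt δ * Real.sqrt (sY * (K * sD) ^ 3)) := by ring
    rw [this]
    have h := mul_le_mul_of_nonneg_left hsq (by positivity : 0 ≤ cn * sY)
    linarith
  calc ∫ x, Gt x ≤ (∫⁻ x, ‖Gt x‖ₑ).toReal := h1
    _ ≤ A * M * W := h5
    _ ≤ A * M * (cn * sY * t ^ 3 + cf * ((1 + sY) * sY * Y)) :=
        mul_le_mul_of_nonneg_left hWle (by positivity)

end Summit.NavierStokesRegularity.NavierStokesRegularity.Theorems.CriticalCoherenceDoor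

end
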